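import Literature.NumberTheory.Irrationality.RhinViola1996.TheoremTwoOne
import HarnessLib

/-!
# Rhin–Viola 1996, Theorem 2.2 (first clause): `d_M d_N a ∈ ℤ` for every `J_q`, with `M, N` of (2.9)

Topic `Literature/NumberTheory/Irrationality/RhinViola1996` (file 6). Source: G. Rhin, C. Viola, *On a permutation group
related to ζ(2)*, Acta Arith. **77** (1996) 23–56 [RhinViola1996], §2 pp. 31–32 (held text `paper:doi-10-4064-aa-77-1-23-56`,
p0009–p0011 read on the page): "The integers `M₀, N₀` defined by (2.4) are invariant under the action of `σ`, but not of `τ`.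
For each `m`, `0 ≤ m ≤ 4`, let `M_m, N_m` be the corresponding integers for the integral `J_m` in (2.3) … Since
`J₀ = … = J₄`, for any `m` and `q` … the pair `M_m, N_m` is admissible for `J_q`. In other words, we have `J_q = a − bζ(2)`
with `b ∈ ℤ` and `d_{M_m} d_{N_m} a ∈ ℤ`." With `τ` acting on the five integers (2.8)
`(j+k−h, k+l−i, l+h−j, h+i−k, i+j−l)` as the cyclic permutation, (2.9) sets `M = max` of (2.8) and
`N = max{τ(M), min{τ²(M), τ³(M)}, τ⁴(M)}`, and **Theorem 2.2** states: for any `q`, `J_q = a − bζ(2)` with `b ∈ ℤ`,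
`d_M d_N a ∈ ℤ`, "and `M, N` is the best among the (unordered) pairs `M_m, N_m`".

PROVED here (the FIRST clause; the optimality clause "best among the pairs" — the case analysis (2.10)–(2.13),
pp. 32–34 — stays QUOTED): in the normalisation of the printed proof ("we may assume with no loss of generality that
`M = i+j−l`; for otherwise we should replace `J₀` with the integral `J_r` such that `M = τ^r(i+j−l)`"), i.e. for the
rotation `τ^r P` whose fifth integer (2.8) is maximal, the pair (2.4) of `τ^r P` IS `(M, N)` of (2.9)
(`max{k+l−i, l+h−j, i+j−l} = i+j−l = M` and `N₀ = max{j+k−h, min{k+l−i, l+h−j}, h+i−k} = max{τ(M), min{τ²(M), τ³(M)}, τ⁴(M)}`),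
so Theorem 2.1 (`theorem21`) for `τ^r P` and the `τ`-invariance of the integral (`invariance_tau`, g44) give the clause
for every `J_q = I(τ^q P)` (`theorem22_admissible`). No definition, no named fact.

HONEST FRAMING (cell pub-zeta5: systematic search; no irrationality claim unless certified): denominators of a 1996 family of
`ζ(2)`-integrals as printed; no measure, no record, nothing about `ζ(5)`; records in print unmoved.

## References
* [RhinViola1996] G. Rhin, C. Viola, Acta Arith. 77 (1996) 23–56, §2 (2.8)–(2.9), Theorem 2.2 (p. 32) and the first
  paragraph of its proof (p. 33).
-/

noncomputable section

namespace Literature.NumberTheory.Irrationality.RhinViola1996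

open Literature.NumberTheory.Transcendental (zetaValue)

/-- `J_q = J₀`: the integral is invariant under every power of `τ` ("since `J₀ = … = J₄`"), from g44's `invariance_tau`.
[cite: RhinViola1996, §2 (2.3), p. 28] -/
theorem I_tau_iterate (q : ℕ) (P : Params) : I (tau^[q] P) = I P := by
  induction q with
  | zero => rfl
  | succ q ih => rw [Function.iterate_succ_apply', invariance_tau, ih]

/-- `τ` preserves non-negativity of the five parameters. [cite: RhinViola1996, §2 (2.2), p. 27] -/
theorem nonneg_tau {P : Params} (hP : P.Nonneg) : (tau P).Nonneg := by
  obtain ⟨h1, h2, h3, h4, h5⟩ := hP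
  exact ⟨h2, h3, h4, h5, h1⟩

/-- Every power of `τ` preserves non-negativity. [cite: RhinViola1996, §2 (2.2), p. 27] -/
theorem nonneg_tau_iterate (r : ℕ) {P : Params} (hP : P.Nonneg) : (tau^[r] P).Nonneg := by
  induction r with
  | zero => exact hP
  | succ r ih => rw [Function.iterate_succ_apply']; exact nonneg_tau ih

/-- `τ` acts on the five integers (2.8) as the cyclic permutation, for every power: `(τ^r P).aux = τ^r (P.aux)`
(from g44's `aux_tau`). [cite: RhinViola1996, §2 p. 32 ("the cyclic permutation … is also called `τ`")] -/
theorem aux_tau_iterate (r : ℕ) (P : Params) : (tau^[r] P).aux = tau^[r] P.aux := by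
  induction r with
  | zero => rfl
  | succ r ih => rw [Function.iterate_succ_apply', Function.iterate_succ_apply', aux_tau, ih]

/-- The entries of `τ^n A` are entries of `A` (a cyclic rearrangement). [cite: RhinViola1996, §2 (2.2), p. 27] -/
private theorem mem_of_mem_tau_iterate (n : ℕ) (A : Params) :
    ∀ x ∈ [(tau^[n] A).h, (tau^[n] A).i, (tau^[n] A).j, (tau^[n] A).k, (tau^[n] A).l], x ∈ [A.h, A.i, A.j, A.k, A.l] := by
  induction n generalizing A with
  | zero => intro x hx; exact hx
  | succ n ih =>
    intro x hx
    rw [Function.iterate_succ_apply] at hx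
    have := ih (tau A) x hx
    simp only [tau, List.mem_cons, List.not_mem_nil, or_false] at this ⊢
    tauto

/-- **Theorem 2.2, first clause** ("for any `q` we have `J_q = a − bζ(2)` with `b ∈ ℤ`, `d_M d_N a ∈ ℤ`"), in the
normalisation of its printed proof: let `r` be such that the fifth integer (2.8) of `Q = τ^r P`, namely
`Q.i + Q.j − Q.l = τ^r(i+j−l)`, is a maximum `M` of the five integers (2.8) of `P` (hypothesis `hM`; such an `r` exists
since `τ` permutes (2.8) cyclically, `aux_tau_iterate`). Then for every `q`, `J_q = I(τ^q P) = a − bζ(2)` with `b ∈ ℤ` and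
`d_M d_N a ∈ ℤ`, where `N = max{τ(M), min{τ²(M), τ³(M)}, τ⁴(M)} = max{Q.j+Q.k−Q.h, min{Q.k+Q.l−Q.i, Q.l+Q.h−Q.j}, Q.h+Q.i−Q.k}`
((2.9) read in the coordinates of `Q`). Proof: Theorem 2.1 for `Q` (its `M₀ = M`, `N₀ = N`) and `J_q = J₀ = I(Q)`.
[cite: RhinViola1996, Theorem 2.2, p. 32] -/
theorem theorem22_admissible {P : Params} (hP : P.Nonneg) (r q : ℕ)
    (hM : P.aux.h ≤ (tau^[r] P).aux.l ∧ P.aux.i ≤ (tau^[r] P).aux.l ∧ P.aux.j ≤ (tau^[r] P).aux.l ∧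
      P.aux.k ≤ (tau^[r] P).aux.l ∧ P.aux.l ≤ (tau^[r] P).aux.l) :
    ∃ (a : ℚ) (b : ℤ), I (tau^[q] P) = a - b * zetaValue 2 ∧ ∃ A : ℤ,
      ((Nat.lcmUpto ((tau^[r] P).aux.l).toNat *
        Nat.lcmUpto (max (max (tau^[r] P).aux.h (min (tau^[r] P).aux.i (tau^[r] P).aux.j)) (tau^[r] P).aux.k).toNat
          : ℕ) : ℚ) * a = A := by
  have hQn : (tau^[r] P).Nonneg := nonneg_tau_iterate r hP
  -- the five integers (2.8) of `Q = τ^r P` are among those of `P`, so `Q.aux.l` dominates them too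
  have hperm : ∀ x ∈ [(tau^[r] P).aux.h, (tau^[r] P).aux.i, (tau^[r] P).aux.j, (tau^[r] P).aux.k, (tau^[r] P).aux.l],
      x ∈ [P.aux.h, P.aux.i, P.aux.j, P.aux.k, P.aux.l] := by
    rw [aux_tau_iterate]
    exact mem_of_mem_tau_iterate r P.aux
  have hall : ∀ x ∈ [P.aux.h, P.aux.i, P.aux.j, P.aux.k, P.aux.l], x ≤ (tau^[r] P).aux.l := by
    intro x hx
    simp only [List.mem_cons, List.not_mem_nil, or_false] at hx
    obtain ⟨h1, h2, h3, h4, h5⟩ := hM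
    rcases hx with rfl | rfl | rfl | rfl | rfl <;> assumption
  have g1 := hall _ (hperm (tau^[r] P).aux.h (by simp))
  have g2 := hall _ (hperm (tau^[r] P).aux.i (by simp))
  have g3 := hall _ (hperm (tau^[r] P).aux.j (by simp))
  have g4 := hall _ (hperm (tau^[r] P).aux.k (by simp))
  -- Theorem 2.1 for `Q`, whose pair (2.4) is `(M, N)`; and `J_q = J₀ = I(Q)`
  have h21 := theorem21 hQn
  rw [I_tau_iterate, ← I_tau_iterate r P]
  generalize tau^[r] P = Q at *
  obtain ⟨qh, qi, qj, qk, ql⟩ := Q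
  obtain ⟨nh, ni, nj, nk, nl⟩ := hQn
  simp only [Params.aux] at g1 g2 g3 g4 h21 nh ni nj nk nl ⊢
  have e1 : (max (max (qk + ql - qi) (ql + qh - qj)) (qi + qj - ql)).toNat = (qi + qj - ql).toNat := by omega
  rw [← e1]
  exact h21

end Literature.NumberTheory.Irrationality.RhinViola1996

end
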